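import Mathlib
import Summits.ResolutionOfSingularities.ResolutionOfSingularities.Theorems.HomologicalConductorPersistenceStaircaseRecords
import Summits.ResolutionOfSingularities.ResolutionOfSingularities.Theorems.HomologicalConductorPersistenceCyclicQuotientMinusTwoModQStair
import HarnessLib

/-!
# Rung S-2 `PersistenceSurface` (stmt-19970), stub C1 (`Sat₄`) — the family `1/n(1,q)`, `n = bq − 2` (`q` odd ≥ 5):
# `ca(k[u,v]^{μ_n(1,q)}) = ca⁴ = s̲ann(M_{−q}) ∩ s̲ann(M_{−2}) ∩ s̲ann(M_{−1})`, kernel-certified UNIFORMLY in `(b, q)`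
# PART B: assembly (chain W4.4b; T-V package, part 29b; seat leafhand-res-homologicalconduct-10 gen 2)

[OURS · L1 w44b · rung S-2] Nothing here is a statement of the manuscript under review (Hironaka 2017);
AI-written, weaker than expert review.

Parts 27/28 certified `n ≡ ±1 (mod q)`.  This file does `n ≡ −2 (mod q)`: `U = k[u,v]^{μ_n(1,q)}`, `n = bq − 2`, `b ≥ 2`, `q ≥ 5` odd
(`ζ` a primitive `n`-th root of unity, `n ∈ kˣ`); `n/q = [b, (q+1)/2, 2]`, `e = 3`, `i`-series `(q, 2, 1)`, cospecial pieces
`M_{−q}, M_{−2}, M_{−1}` (the case `q = 3` is `n ≡ 1 (mod 3)`, part 27).  It is the first family whose record staircase needs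
the TWO-LEVEL recursion of the hand memo HAND10G2-TORIC-FAMILIES §1 (`drops_{(n,q)}(α) = q^{⌊α/q⌋} ++ drops_{(q,2)}(α mod q)`): for
a class `a` with `a.val = α = qA + ρ`, `ρ = 2A' + ρ'`,

* `u^{α − qs} v^{s}` (`s ≤ A`, drops `q`), then `u^{ρ − 2s'} v^{A + bs'}` (`1 ≤ s' ≤ A'`, drops `2`), then — when `ρ` is odd — the
  generator `v^{J}`, `J = A + bA' + (b − 1) + b(q−1)/2` (from `u v^{A+bA'}` the orbit climbs to `q − 1` and descends by `2`):
  one drop `1`; so `Ω M_a ≅ M_{−q}^{A} ⊕ M_{−2}^{A'} ⊕ M_{−1}^{ρ'}`;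
* Ω-stability: `M_{−q} | Ω M_{−1}` (position `0`), `M_{−2} | Ω M_{−q}` (position `b − 2`), `M_{−1} | Ω M_{−q}`
  (position `b − 2 + (q−3)/2`);
* **`cohomologyAnnihilator_minusTwo_mod_q`** — for every `b ≥ 2`, odd `q ≥ 5`, `n = bq − 2`: `ca(U) = ca⁴(U)` and
  `x ∈ ca(U) ↔ x ∈ s̲ann(M_{−q}) ∩ s̲ann(M_{−2}) ∩ s̲ann(M_{−1})`.

The ring identities and the cover property live in part A (`…CyclicQuotientMinusTwoModQStair`); this file assembles.

References: folklore (Auslander 1986 / Herzog 1978 mechanism; Wunram 1988, Riemenschneider 1974); hand memo HAND10G2-TORIC-FAMILIES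
(OURS, evidence on stmt-19970).
-/

-- single-problem summit: the doubled namespace component `ResolutionOfSingularities` is forced
set_option linter.dupNamespace false

noncomputable section

open CategoryTheory Literature.RingTheory.CohomologyAnnihilator MvPolynomial
open Summit.ResolutionOfSingularities.ResolutionOfSingularities.Theorems.NoZeno.SandwichCluster
open Summit.ResolutionOfSingularities.ResolutionOfSingularities.Theorems.HomologicalConductor.PersistenceAddCoverFamily
open Summit.ResolutionOfSingularities.ResolutionOfSingularities.Theorems.HomologicalConductor.PersistenceCyclicQuotientIsotypic
open Summit.ResolutionOfSingularities.ResolutionOfSingularities.Theorems.HomologicalConductor.PersistenceCyclicQuotientIsotypicPieces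
open Summit.ResolutionOfSingularities.ResolutionOfSingularities.Theorems.HomologicalConductor.PersistenceStaircaseRecords
open Summit.ResolutionOfSingularities.ResolutionOfSingularities.Theorems.HomologicalConductor.PersistenceCyclicQuotientOneModQ
  (natCast_val_add_mul_self val_sub_natCast_eq val_neg_natCast)

universe u

namespace Summit.ResolutionOfSingularities.ResolutionOfSingularities.Theorems.HomologicalConductor.PersistenceCyclicQuotientMinusTwoModQ

/-! ## The certificate -/

variable {k : Type u} [Field k] {n : ℕ} [NeZero n] {ζ : k} (hζ : IsPrimitiveRoot ζ n) (hn : (n : k) ≠ 0)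
variable {q : ℕ} (U : Subalgebra k (MvPolynomial (Fin 2) k))
variable (hU : ∀ p, p ∈ U ↔ aeval (fun i : Fin 2 => C (ζ ^ (![1, q] : Fin 2 → ℕ) i) * X i) p = p)

set_option maxHeartbeats 1600000 in
set_option synthInstance.maxHeartbeats 400000 in
include hζ hn hU in
/-- **`Sat₄` and the exact centre for `k[u,v]^{μ_n(1,q)}` whenever `n = bq − 2` (`b ≥ 2`, `q ≥ 5` odd), kernel-certified
uniformly in `(b, q)`.**  With the weight pieces `M a = {p | σ₀ p = ζ^a p}` (`σ₀ : u ↦ ζu, v ↦ ζ^{q}v`): `ca(U) = ca⁴(U)` and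
`x ∈ ca(U) ↔ x` stably annihilates `M_{−q}`, `M_{−2}`, `M_{−1}` (the duals of the specials; `i`-series `(q,2,1)` of
`n/q = [b, (q+1)/2, 2]`).  (Budgets raised locally as in parts 21–28.) [OURS · L1 w44b] -/
theorem cohomologyAnnihilator_minusTwo_mod_q (b : ℕ) (hb : 2 ≤ b) (hq : 5 ≤ q) (hqodd : q % 2 = 1)
    (hnq : n = b * q - 2) :
    ∃ M : ZMod n → Submodule U ((restrictScalarsFunctor U (MvPolynomial (Fin 2) k)).obj
        (ModuleCat.of (MvPolynomial (Fin 2) k) (MvPolynomial (Fin 2) k))),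
      (∀ (a : ZMod n) (p : MvPolynomial (Fin 2) k),
        (show ((restrictScalarsFunctor U (MvPolynomial (Fin 2) k)).obj
          (ModuleCat.of (MvPolynomial (Fin 2) k) (MvPolynomial (Fin 2) k))) from p) ∈ M a ↔
        aeval (fun i : Fin 2 => C (ζ ^ (![1, q] : Fin 2 → ℕ) i) * X i) p = C (ζ ^ a.val) * p) ∧
      cohomologyAnnihilator U = cohomologyAnnihilatorOfDegree U 4 ∧
      ∀ x : U, x ∈ cohomologyAnnihilator U ↔
        ∀ t : Fin 3, StablyAnnihilates U x
          (@ModuleCat.of U _ (M (![-((q : ℕ) : ZMod n), -((2 : ℕ) : ZMod n), -((1 : ℕ) : ZMod n)] t)) _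
            (M (![-((q : ℕ) : ZMod n), -((2 : ℕ) : ZMod n), -((1 : ℕ) : ZMod n)] t)).module) := by
  classical
  obtain ⟨h, hqh⟩ : ∃ h, q = 2 * h + 1 := ⟨q / 2, by omega⟩
  have hh : 2 ≤ h := by omega
  have hbq : 2 * q ≤ b * q := Nat.mul_le_mul_right q hb
  have hbq2 : 2 ≤ b * q := by omega
  have hcop : Nat.Coprime q n := by
    -- `b q = n + 2` and `q` is odd, so a common divisor of `q` and `n` divides `2` and is odd
    rw [Nat.coprime_comm, Nat.coprime_iff_gcd_eq_one]
    have h1 : Nat.gcd n q ∣ n := Nat.gcd_dvd_left n q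
    have h2 : Nat.gcd n q ∣ b * q := Dvd.dvd.mul_left (Nat.gcd_dvd_right n q) b
    have h3 : Nat.gcd n q ∣ b * q - n := Nat.dvd_sub h2 h1
    rw [show b * q - n = 2 by omega] at h3
    have h4 : Nat.gcd n q ∣ q := Nat.gcd_dvd_right n q
    have h5 : Nat.gcd n q ≤ 2 := Nat.le_of_dvd (by norm_num) h3
    interval_cases hg : Nat.gcd n q
    · exact absurd (Nat.eq_zero_of_zero_dvd h4) (by omega)
    · rfl
    · exact absurd (Nat.mod_eq_zero_of_dvd h4) (by omega)
  obtain ⟨M, hM, ⟨e⟩⟩ := exists_isotypic_splitting hζ hn hcop U hU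
  have hqn : q < n := by omega
  have hval : ∀ a : ZMod n, a.val < n := fun a => ZMod.val_lt a
  have hdm : ∀ a : ZMod n, q * (a.val / q) + a.val % q = a.val := fun a => Nat.div_add_mod _ _
  have hml : ∀ a : ZMod n, a.val % q < q := fun a => Nat.mod_lt _ (by omega)
  -- per-class staircase data, `α = qA + ρ`, `ρ = 2A' + ρ'`
  let A : ZMod n → ℕ := fun a => a.val / q
  let ρ : ZMod n → ℕ := fun a => a.val % q
  let A' : ZMod n → ℕ := fun a => a.val % q / 2
  let P : ZMod n → ℕ := fun a => A a + b * A' a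
  let μ : ZMod n → ℕ := fun a => A a + A' a + ρ a % 2
  let J : ZMod n → ℕ := fun a => if ρ a % 2 = 1 then P a + (b - 1) + b * h else P a
  let c : ZMod n → ℕ → ℕ := fun a s =>
    if s ≤ A a then a.val - q * s else if s ≤ A a + A' a then ρ a - 2 * (s - A a) else 0
  let j : ZMod n → ℕ → ℕ := fun a s =>
    if s ≤ A a then s else if s ≤ A a + A' a then A a + b * (s - A a) else J a
  let d : ZMod n → ℕ → ZMod n := fun a t =>
    if t < A a then -((q : ℕ) : ZMod n) else if t < A a + A' a then -((2 : ℕ) : ZMod n) else -((1 : ℕ) : ZMod n)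
  have hPJ : ∀ a, P a ≤ J a := fun a => by dsimp only [J]; split_ifs <;> omega
  have hc_anti : ∀ a, Antitone (c a) := by
    intro a s t hst
    have hA := hdm a
    have h1 : s ≤ a.val / q → q * s ≤ q * (a.val / q) := fun h => Nat.mul_le_mul_left q h
    have h2 := Nat.mul_le_mul_left q hst
    have h3 : a.val % q / 2 * 2 ≤ a.val % q := Nat.div_mul_le_self _ _
    dsimp only [c, A, ρ, A']
    split_ifs <;> omega
  have hj_mono : ∀ a, Monotone (j a) := by
    intro a s t hst
    have := hPJ a
    have h2 : b * (s - a.val / q) ≤ b * (t - a.val / q) := Nat.mul_le_mul_left b (by omega)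
    have h3 : t ≤ a.val / q + a.val % q / 2 → b * (t - a.val / q) ≤ b * (a.val % q / 2) :=
      fun h => Nat.mul_le_mul_left b (by omega)
    have h4 : s ≤ a.val / q + a.val % q / 2 → b * (s - a.val / q) ≤ b * (a.val % q / 2) :=
      fun h => Nat.mul_le_mul_left b (by omega)
    dsimp only [j, J, P, A, ρ, A']
    split_ifs <;> omega
  -- the class of every generator
  have hcl : ∀ a s, ((c a s + q * j a s : ℕ) : ZMod n) = a := by
    intro a s
    have hA := hdm a
    have hρq := hml a
    dsimp only [c, j, J, P, A, ρ, A']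
    by_cases hs : s ≤ a.val / q
    · have := Nat.mul_le_mul_left q hs
      rw [if_pos hs, if_pos hs, show a.val - q * s + q * s = a.val by omega, ZMod.natCast_zmod_val]
    · rw [if_neg hs, if_neg hs]
      by_cases hs2 : s ≤ a.val / q + a.val % q / 2
      · rw [if_pos hs2, if_pos hs2, stair2_identity q b (a.val / q) (a.val % q) (s - a.val / q) (by omega) hbq2, hA,
          ← hnq, natCast_val_add_mul_self]
      · rw [if_neg hs2, if_neg hs2, zero_add]
        by_cases hodd : a.val % q % 2 = 1
        · rw [if_pos hodd, stair3_identity q b (a.val / q) (a.val % q / 2) h hqh (by omega) hbq2,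
            show q * (a.val / q) + 2 * (a.val % q / 2) + 1 = a.val by omega, ← hnq, natCast_val_add_mul_self]
        · have hP := stair2_identity q b (a.val / q) (a.val % q) (a.val % q / 2) (by omega) hbq2
          rw [← hnq] at hP
          rw [if_neg hodd, show q * (a.val / q + b * (a.val % q / 2)) = a.val + (a.val % q / 2) * n by omega,
            natCast_val_add_mul_self]
  -- the drop classes
  have hψ : ∀ a t, t < μ a → d a t = a - ((c a t + q * j a (t + 1) : ℕ) : ZMod n) := by
    intro a t ht
    have hA := hdm a
    have hρq := hml a
    dsimp only [μ, A, ρ, A'] at ht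
    dsimp only [d, c, j, J, P, A, ρ, A']
    by_cases htA : t < a.val / q
    · have := Nat.mul_le_mul_left q (le_of_lt htA)
      rw [if_pos htA, if_pos (le_of_lt htA), if_pos (Nat.succ_le_of_lt htA),
        show a.val - q * t + q * (t + 1) = a.val + q by rw [Nat.mul_succ]; omega, Nat.cast_add,
        ZMod.natCast_zmod_val]
      ring
    · rw [if_neg htA, if_neg (show ¬ (t + 1 ≤ a.val / q) by omega)]
      by_cases ht2 : t < a.val / q + a.val % q / 2
      · -- a `2`-drop: generator `u^{ρ−2t'} v^{A+bt'}` followed by `u^{ρ−2t'−2} v^{A+b(t'+1)}`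
        rw [if_pos ht2, if_pos (show t + 1 ≤ a.val / q + a.val % q / 2 by omega)]
        by_cases htA' : t ≤ a.val / q
        · have ht0 : t = a.val / q := by omega
          rw [if_pos htA', ht0, show a.val - q * (a.val / q) = a.val % q - 2 * 0 by omega,
            show a.val / q + 1 - a.val / q = 0 + 1 by omega,
            drop2_identity q b (a.val / q) (a.val % q) 0 (by omega) hbq2, hA, ← hnq, Nat.cast_add,
            natCast_val_add_mul_self, Nat.cast_ofNat]
          ring
        · rw [if_neg htA', if_pos (le_of_lt ht2), show t + 1 - a.val / q = (t - a.val / q) + 1 by omega,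
            drop2_identity q b (a.val / q) (a.val % q) (t - a.val / q) (by omega) hbq2, hA, ← hnq, Nat.cast_add,
            natCast_val_add_mul_self, Nat.cast_ofNat]
          ring
      · -- the last drop `1` (odd `ρ`): generator `u v^{P}` followed by `v^{J}`
        have hodd : a.val % q % 2 = 1 := by omega
        have htP : t = a.val / q + a.val % q / 2 := by omega
        rw [if_neg ht2, if_neg (show ¬ (t + 1 ≤ a.val / q + a.val % q / 2) by omega), if_pos hodd]
        by_cases htA' : t ≤ a.val / q
        · -- `A' = 0`: the generator is `u^{ρ} v^{A}` with `ρ = 1`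
          have hA'0 : a.val % q / 2 = 0 := by omega
          rw [if_pos htA', show a.val - q * t = 1 by rw [htP, hA'0, Nat.add_zero]; omega,
            stair3_identity q b (a.val / q) (a.val % q / 2) h hqh (by omega) hbq2,
            show q * (a.val / q) + 2 * (a.val % q / 2) + 1 = a.val by omega, ← hnq,
            show 1 + (a.val + (a.val % q / 2 + h + 1) * n) = a.val + (a.val % q / 2 + h + 1) * n + 1 by ring,
            Nat.cast_add, natCast_val_add_mul_self, Nat.cast_one]
          ring
        · rw [if_neg htA', if_pos (le_of_eq htP), show a.val % q - 2 * (t - a.val / q) = 1 by omega,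
            stair3_identity q b (a.val / q) (a.val % q / 2) h hqh (by omega) hbq2,
            show q * (a.val / q) + 2 * (a.val % q / 2) + 1 = a.val by omega, ← hnq,
            show 1 + (a.val + (a.val % q / 2 + h + 1) * n) = a.val + (a.val % q / 2 + h + 1) * n + 1 by ring,
            Nat.cast_add, natCast_val_add_mul_self, Nat.cast_one]
          ring
  -- `q J ≡ a`
  have hJ : ∀ a, ((q * J a : ℕ) : ZMod n) = a := by
    intro a
    have hA := hdm a
    have hρq := hml a
    dsimp only [J, P, A, ρ, A']
    by_cases hodd : a.val % q % 2 = 1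
    · rw [if_pos hodd, stair3_identity q b (a.val / q) (a.val % q / 2) h hqh (by omega) hbq2,
        show q * (a.val / q) + 2 * (a.val % q / 2) + 1 = a.val by omega, ← hnq, natCast_val_add_mul_self]
    · have hP := stair2_identity q b (a.val / q) (a.val % q) (a.val % q / 2) (by omega) hbq2
      rw [← hnq] at hP
      rw [if_neg hodd, show q * (a.val / q + b * (a.val % q / 2)) = a.val + (a.val % q / 2) * n by omega,
        natCast_val_add_mul_self]
  -- the cover property on `[0, J]`
  have hcov : ∀ a i, i ≤ J a → ∃ s, s ≤ μ a ∧ j a s ≤ i ∧ c a s ≤ ((a - ((q * i : ℕ) : ZMod n) : ZMod n)).val :=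
    fun a i hi => cover_minusTwo_mod_q hqh hb hq hnq a i hi
  -- the staircase resolutions `Ω M_a ≅ Π_{t < μ a} M (d a t)`
  let M' : ZMod n → ModuleCat.{u} U := fun a => @ModuleCat.of U _ (M a) _ (M a).module
  let K : ZMod n → ModuleCat.{u} U := fun a => ModuleCat.of U (Π t : Fin (μ a), M (d a t))
  have hK : ∀ a, IsSyzygy 1 (M' a) (K a) := by
    intro a
    refine isSyzygy_one_staircase_of_lt hζ U hU M hM a (μ a) (c a) (j a) (hc_anti a) (hj_mono a) (hcl a)
      (d a) (hψ a) ?_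
    exact isotypic_le_span_of_cover hζ U hU M hM a (μ a) (J a) (c a) (j a) (hcl a) (hJ a) (hcov a)
  -- the certificate data: distinguished family `{M_{−q}, M_{−2}, M_{−1}}`
  let ψ' : Fin 3 → ZMod n := ![-((q : ℕ) : ZMod n), -((2 : ℕ) : ZMod n), -((1 : ℕ) : ZMod n)]
  have hdψ : ∀ a t, ∃ s : Fin 3, d a t = ψ' s := by
    intro a t
    dsimp only [d]
    by_cases h1 : t < A a
    · exact ⟨0, by rw [if_pos h1]; rfl⟩
    · by_cases h2 : t < A a + A' a
      · exact ⟨1, by rw [if_neg h1, if_pos h2]; rfl⟩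
      · exact ⟨2, by rw [if_neg h1, if_neg h2]; rfl⟩
  have hfin : ∀ t, Module.Finite U (M' (ψ' t)) := fun t => finite_isotypic hζ q U hU M hM _
  have hKD : ∀ a, IsRetractOfPower (ModuleCat.of U ((Π t, M' (ψ' t)) × U)) (K a) := by
    intro a
    refine IsRetractOfPower.piFamily (fun t : Fin (μ a) => M' (d a t)) fun t => ?_
    obtain ⟨s, heq⟩ := hdψ a t
    exact (isRetractOfPower_fst (ModuleCat.of U (Π t, M' (ψ' t))) (ModuleCat.of U U)).of_isRetractOfPower_gen
      ((isRetractOfPower_eval (fun t : Fin 3 => M' (ψ' t)) s).of_iso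
        (LinearEquiv.toModuleIso (LinearEquiv.ofEq _ _ (by rw [heq]))))
  have hD : ∀ t, ∃ (s : Fin 3) (i : M' (ψ' t) ⟶ K (ψ' s)) (r : K (ψ' s) ⟶ M' (ψ' t)),
      i ≫ r = 𝟙 (M' (ψ' t)) := by
    -- sources: `M_{−q} | Ω M_{−1}` @0; `M_{−2} | Ω M_{−q}` @(b−2); `M_{−1} | Ω M_{−q}` @(b−2+h−1)
    have hv1 : (ψ' 2).val = n - 1 := val_neg_natCast (by norm_num) (by omega)
    have hvq : (ψ' 0).val = n - q := val_neg_natCast (by omega) (by omega)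
    have hAρ1 : A (ψ' 2) = b - 1 ∧ ρ (ψ' 2) = q - 3 := by
      refine (Nat.div_mod_unique (by omega)).mpr ⟨?_, by omega⟩
      rw [hv1, hnq]
      obtain ⟨b', rfl⟩ : ∃ b', b = b' + 1 := ⟨b - 1, by omega⟩
      have hcomm : q * b' = b' * q := Nat.mul_comm _ _
      rw [Nat.add_sub_cancel, Nat.add_mul, one_mul]
      omega
    have hAρq : A (ψ' 0) = b - 2 ∧ ρ (ψ' 0) = q - 2 := by
      refine (Nat.div_mod_unique (by omega)).mpr ⟨?_, by omega⟩
      rw [hvq, hnq]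
      obtain ⟨b', rfl⟩ : ∃ b', b = b' + 2 := ⟨b - 2, by omega⟩
      have hcomm : q * b' = b' * q := Nat.mul_comm _ _
      rw [Nat.add_sub_cancel, Nat.add_mul]
      omega
    have hA'q : A' (ψ' 0) = h - 1 := by
      change ρ (ψ' 0) / 2 = h - 1
      rw [hAρq.2]; omega
    have hsrc : ∀ t : Fin 3, ∃ (s : Fin 3) (p : Fin (μ (ψ' s))), d (ψ' s) p = ψ' t := by
      have hA'1 : A' (ψ' 2) = (q - 3) / 2 := by
        change ρ (ψ' 2) / 2 = (q - 3) / 2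
        rw [hAρ1.2]
      have hμ1 : μ (ψ' 2) = b - 1 + (q - 3) / 2 + (q - 3) % 2 := by simp only [μ, hAρ1.1, hA'1, hAρ1.2]
      have hμq : μ (ψ' 0) = b - 2 + (h - 1) + (q - 2) % 2 := by
        simp only [μ, hAρq.1, hA'q, hAρq.2]
      intro t
      fin_cases t
      · refine ⟨2, ⟨0, by rw [hμ1]; omega⟩, ?_⟩
        change d (ψ' 2) 0 = ψ' 0
        simp only [d, hAρ1.1]
        rw [if_pos (by omega)]
        rfl
      · refine ⟨0, ⟨b - 2, by rw [hμq]; omega⟩, ?_⟩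
        change d (ψ' 0) (b - 2) = ψ' 1
        simp only [d, hAρq.1, hA'q, lt_irrefl, if_false]
        rw [if_pos (by omega)]
        rfl
      · refine ⟨0, ⟨b - 2 + (h - 1), by rw [hμq]; omega⟩, ?_⟩
        change d (ψ' 0) (b - 2 + (h - 1)) = ψ' 2
        simp only [d, hAρq.1, hA'q, lt_irrefl, if_false]
        rw [if_neg (by omega)]
        rfl
    intro t
    obtain ⟨s, p, hp⟩ := hsrc t
    let E : M (d (ψ' s) p) ≃ₗ[U] M (ψ' t) := LinearEquiv.ofEq _ _ (by rw [hp])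
    refine ⟨s,
      @ModuleCat.ofHom U _ (M (ψ' t)) (Π t' : Fin (μ (ψ' s)), M (d (ψ' s) t'))
        _ (M (ψ' t)).module _ _
        ((LinearMap.single U (fun t' : Fin (μ (ψ' s)) => M (d (ψ' s) t')) p) ∘ₗ E.symm.toLinearMap),
      @ModuleCat.ofHom U _ (Π t' : Fin (μ (ψ' s)), M (d (ψ' s) t')) (M (ψ' t))
        _ _ _ (M (ψ' t)).module (E.toLinearMap ∘ₗ LinearMap.proj p), ?_⟩
    apply ModuleCat.hom_ext
    refine LinearMap.ext fun x => ?_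
    change E ((Pi.single p (E.symm x) : Π t' : Fin (μ (ψ' s)), M (d (ψ' s) t')) p) = x
    rw [Pi.single_eq_same, LinearEquiv.apply_symm_apply]
  obtain ⟨h4, hiff⟩ := @cohomologyAnnihilator_eq_four_of_isotypicData k _ n _ ζ hζ hn q hcop U hU (Fin 3) _ M' e
    K hK ψ' hfin hKD hD
  exact ⟨M, hM, h4, hiff⟩

end Summit.ResolutionOfSingularities.ResolutionOfSingularities.Theorems.HomologicalConductor.PersistenceCyclicQuotientMinusTwoModQ

end
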